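import Summits.NavierStokesRegularity.FluidComputer.RiccatiSlice
import HarnessLib

/-!
# Fluid computer — support: the Riccati summation at a GENERAL weight `2^{κj}`, `0 ≤ κ < 5`
# (towards the optimal `Ḣ^s` rows for `3/2 < s < 5/2`, Cheskidov–Zaya 2016 Remark 2.3)

HONEST FRAMING (cell `pub-fluidc`, verbatim): *low prior, high value-of-information experiment on Tao's
machine paradigm; NOT a claim that NS blows up.* Support file (pure bookkeeping on sequences of levels; no fluid
content). `RiccatiSummation.riccati_summation` (weight `8^j`, the `Ḃ^{3/2}_{2,2}` row) generalises verbatim to every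
weight `2^{κj}`, `0 ≤ κ < 5`, with the SAME partner `D₅ = ∑_j 32^j a_j²`: for `a, s ≥ 0` on `ℤ` with the Bernstein
relation `s_l ≤ C_B 2^{3l/2} a_l`, and `y_κ = ∑_j 2^{κj} a_j²`,

  `∑_j 2^{κj} (a_j ∑_{|m|≤2} a_{j+m} T_{j+m} + s_j Q_j) ≤ C_κ · C_B · y_κ · D₅^{1/2}`

(`T = paraT (2^· s)`, `Q = paraQ2 a (2^· a)`, the shapes of the tree's low-mode block bound). The point: `2^{κj} a_j`
against the coarse strain `T_{j+m} ≲ 2^{(5−κ)(j+m)/2} y_κ^{1/2}` pairs the `Ḃ^{κ/2}_{2,2}` amplitude `2^{κj/2}a_j` with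
`2^{5j/2} a_j` whatever `κ` is (`paraT_weighted_le_gen`, `lowHigh_weighted_le_gen`, `highHigh_weighted_le_gen`,
`riccati_summation_gen`). For `κ = 2s ∈ [3, 5)` Hölder gives `D₅ ≤ y_κ^{s−3/2} D_κ^{5/2−s}` with the dissipation row
`D_κ = ∑_j 2^{(κ+2)j} a_j²`, whence Cheskidov–Zaya's `y' ≲ ν^{…} y^{(2s+1)/(2s−1)}` for `3/2 ≤ s < 5/2` — the successor's
use. 0 sorry; no definitions; no named facts.

## References

* A. Cheskidov, K. Zaya, J. Math. Phys. 57 (2016) 023101 = arXiv:1503.01784, Thm. 2.2 and Remark 2.3 (p. 6).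
  [CheskidovZaya2016]
-/

noncomputable section

open MeasureTheory Set Function Filter Topology Metric
open scoped ENNReal NNReal
open Literature.Analysis.FluidPDE Literature.Analysis.FunctionSpaces
open Summit.NavierStokesRegularity.FluidComputer.RiccatiSummationTools

namespace Summit.NavierStokesRegularity.FluidComputer.RiccatiSummationGen

/-- `2^{a+b} = 2^a 2^b` in `ℝ≥0∞` (real exponents). [folklore] -/
theorem two_rpow_add (a b : ℝ) : (2 : ℝ≥0∞) ^ (a + b) = (2 : ℝ≥0∞) ^ a * (2 : ℝ≥0∞) ^ b :=
  ENNReal.rpow_add _ _ two_ne_zero ENNReal.ofNat_ne_top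

/-- The `κ`-row of the amplitudes `x_k = 2^{κk/2} a_k` squares to the weights `2^{κk}`: `∑_k x_k² = ∑_k 2^{κk} a_k²`.
[folklore] -/
theorem tsum_half_sq (κ : ℝ) (a : ℤ → ℝ≥0∞) :
    ∑' k : ℤ, ((2 : ℝ≥0∞) ^ (κ / 2 * (k : ℝ)) * a k) ^ 2 = ∑' k : ℤ, (2 : ℝ≥0∞) ^ (κ * (k : ℝ)) * a k ^ 2 := by
  refine tsum_congr fun k => ?_
  rw [mul_pow, ← ENNReal.rpow_natCast ((2 : ℝ≥0∞) ^ _) 2, ← ENNReal.rpow_mul]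
  congr 2; push_cast; ring

/-- A geometric series with ratio `2^{−c}`, `c > 0`, is finite. [folklore] -/
theorem tsum_geom_ne_top {c : ℝ} (hc : 0 < c) : ∑' n : ℕ, ((2 : ℝ≥0∞) ^ (-c)) ^ n ≠ ∞ := by
  rw [ENNReal.tsum_geometric]
  refine ENNReal.inv_ne_top.2 (ne_of_gt (tsub_pos_of_lt ?_))
  calc (2 : ℝ≥0∞) ^ (-c) < (2 : ℝ≥0∞) ^ (0 : ℝ) :=
        ENNReal.rpow_lt_rpow_of_exponent_lt (by norm_num) (by norm_num) (by linarith)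
    _ = 1 := ENNReal.rpow_zero

variable (a s : ℤ → ℝ≥0∞) (CB : ℝ≥0∞)

/-- **Bound on the coarse strain at weight `κ`** (`κ < 5`): with `s_l ≤ C_B 2^{3l/2} a_l`, for every `l ∈ ℤ`,
`∑_{n≥0} 2^{l−3−n} s_{l−3−n} ≤ C_B · 2^{(5−κ)(l−3)/2} · G_κ · (∑_j 2^{κj} a_j²)^{1/2}`, `G_κ = (∑_n 2^{−(5−κ)n/2})^{1/2}`
(Bernstein and `tsum_shift_le_sqrt` with `c = (5−κ)/2`). At `κ = 3` this is `RiccatiSummationTools.paraT_weighted_le`.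
[cite: CheskidovZaya2016, Thm. 2.2 (proof), Remark 2.3] -/
theorem paraT_weighted_le_gen {κ : ℝ} (hκ5 : κ < 5)
    (hB : ∀ l : ℤ, s l ≤ CB * (2 : ℝ≥0∞) ^ ((3 / 2 : ℝ) * (l : ℝ)) * a l) (l : ℤ) :
    paraT (fun l' => (2 : ℝ≥0∞) ^ l' * s l') l ≤
      CB * (2 : ℝ≥0∞) ^ ((5 - κ) / 2 * ((l : ℝ) - 3)) *
        ((∑' n : ℕ, ((2 : ℝ≥0∞) ^ (-((5 - κ) / 2))) ^ n) ^ (1 / 2 : ℝ) *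
          (∑' j : ℤ, (2 : ℝ≥0∞) ^ (κ * (j : ℝ)) * a j ^ 2) ^ (1 / 2 : ℝ)) := by
  set c : ℝ := (5 - κ) / 2 with hc
  have hc0 : 0 ≤ c := by rw [hc]; linarith
  set q : ℤ := l - 3 with hq
  set x : ℤ → ℝ≥0∞ := fun k => (2 : ℝ≥0∞) ^ (κ / 2 * (k : ℝ)) * a k with hx
  have hterm : ∀ n : ℕ, (2 : ℝ≥0∞) ^ (l - 3 - (n : ℤ)) * s (l - 3 - n) ≤
      CB * (2 : ℝ≥0∞) ^ (c * ((l : ℝ) - 3)) * ((2 : ℝ≥0∞) ^ (-c * (n : ℝ)) * x (q - n)) := by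
    intro n
    have e : l - 3 - (n : ℤ) = q - n := by rw [hq]
    rw [e]
    calc (2 : ℝ≥0∞) ^ (q - (n : ℤ)) * s (q - n)
        ≤ (2 : ℝ≥0∞) ^ (q - (n : ℤ)) * (CB * (2 : ℝ≥0∞) ^ ((3 / 2 : ℝ) * ((q - n : ℤ) : ℝ)) * a (q - n)) :=
          mul_le_mul' le_rfl (hB _)
      _ = CB * (2 : ℝ≥0∞) ^ (c * ((l : ℝ) - 3)) * ((2 : ℝ≥0∞) ^ (-c * (n : ℝ)) * x (q - n)) := by
          simp only [hx]
          rw [← ENNReal.rpow_intCast]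
          have e1 : ((q - (n : ℤ) : ℤ) : ℝ) = (l : ℝ) - 3 - n := by rw [hq]; push_cast; ring
          rw [e1]
          have e2 : (2 : ℝ≥0∞) ^ ((l : ℝ) - 3 - n) * (2 : ℝ≥0∞) ^ ((3 / 2 : ℝ) * ((l : ℝ) - 3 - n)) =
              (2 : ℝ≥0∞) ^ (c * ((l : ℝ) - 3)) * (2 : ℝ≥0∞) ^ (-c * (n : ℝ)) *
                (2 : ℝ≥0∞) ^ (κ / 2 * ((l : ℝ) - 3 - n)) := by
            rw [← two_rpow_add, ← two_rpow_add, ← two_rpow_add]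
            congr 1; rw [hc]; ring
          calc (2 : ℝ≥0∞) ^ ((l : ℝ) - 3 - n) * (CB * (2 : ℝ≥0∞) ^ ((3 / 2 : ℝ) * ((l : ℝ) - 3 - n)) * a (q - n))
              = CB * ((2 : ℝ≥0∞) ^ ((l : ℝ) - 3 - n) * (2 : ℝ≥0∞) ^ ((3 / 2 : ℝ) * ((l : ℝ) - 3 - n))) *
                  a (q - n) := by ring
            _ = _ := by rw [e2]; ring
  calc paraT (fun l' => (2 : ℝ≥0∞) ^ l' * s l') l
      = ∑' n : ℕ, (2 : ℝ≥0∞) ^ (l - 3 - (n : ℤ)) * s (l - 3 - n) := rfl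
    _ ≤ ∑' n : ℕ, CB * (2 : ℝ≥0∞) ^ (c * ((l : ℝ) - 3)) * ((2 : ℝ≥0∞) ^ (-c * (n : ℝ)) * x (q - n)) :=
        ENNReal.tsum_le_tsum hterm
    _ = CB * (2 : ℝ≥0∞) ^ (c * ((l : ℝ) - 3)) * ∑' n : ℕ, (2 : ℝ≥0∞) ^ (-c * (n : ℝ)) * x (q - n) :=
        ENNReal.tsum_mul_left
    _ ≤ CB * (2 : ℝ≥0∞) ^ (c * ((l : ℝ) - 3)) *
          ((∑' n : ℕ, ((2 : ℝ≥0∞) ^ (-c)) ^ n) ^ (1 / 2 : ℝ) * (∑' k : ℤ, x k ^ 2) ^ (1 / 2 : ℝ)) :=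
        mul_le_mul' le_rfl (tsum_shift_le_sqrt x q hc0)
    _ = _ := by rw [hx, tsum_half_sq]

/-- **The low–high (coarse-strain) sum at weight `2^{κj}`** (`0 ≤ κ < 5`): with `s_l ≤ C_B 2^{3l/2} a_l`, for every
`m ≥ −2`, `∑_j 2^{κj} a_j a_{j+m} T_{j+m} ≤ C_B · 2^κ · G_κ · (∑_j 2^{κj} a_j²) · (∑_j 32^j a_j²)^{1/2}`
(`paraT_weighted_le_gen`, then the shifted Cauchy–Schwarz between `2^{κj/2} a_j` and `2^{5(j+m)/2} a_{j+m}`).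
[cite: CheskidovZaya2016, Thm. 2.2 (proof), Remark 2.3] -/
theorem lowHigh_weighted_le_gen {κ : ℝ} (hκ0 : 0 ≤ κ) (hκ5 : κ < 5)
    (hB : ∀ l : ℤ, s l ≤ CB * (2 : ℝ≥0∞) ^ ((3 / 2 : ℝ) * (l : ℝ)) * a l) (m : ℤ) (hm : -2 ≤ m) :
    ∑' j : ℤ, (2 : ℝ≥0∞) ^ (κ * (j : ℝ)) *
        (a j * (a (j + m) * paraT (fun l' => (2 : ℝ≥0∞) ^ l' * s l') (j + m))) ≤
      CB * (2 : ℝ≥0∞) ^ κ * (∑' n : ℕ, ((2 : ℝ≥0∞) ^ (-((5 - κ) / 2))) ^ n) ^ (1 / 2 : ℝ) *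
        (∑' j : ℤ, (2 : ℝ≥0∞) ^ (κ * (j : ℝ)) * a j ^ 2) *
          (∑' j : ℤ, (2 : ℝ≥0∞) ^ ((5 : ℝ) * (j : ℝ)) * a j ^ 2) ^ (1 / 2 : ℝ) := by
  set c : ℝ := (5 - κ) / 2 with hc
  have hc0 : 0 ≤ c := by rw [hc]; linarith
  set Y : ℝ≥0∞ := ∑' j : ℤ, (2 : ℝ≥0∞) ^ (κ * (j : ℝ)) * a j ^ 2 with hY
  set D : ℝ≥0∞ := ∑' j : ℤ, (2 : ℝ≥0∞) ^ ((5 : ℝ) * (j : ℝ)) * a j ^ 2 with hD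
  set G : ℝ≥0∞ := (∑' n : ℕ, ((2 : ℝ≥0∞) ^ (-c)) ^ n) ^ (1 / 2 : ℝ) with hG
  set x : ℤ → ℝ≥0∞ := fun k => (2 : ℝ≥0∞) ^ (κ / 2 * (k : ℝ)) * a k with hx
  set z : ℤ → ℝ≥0∞ := fun k => (2 : ℝ≥0∞) ^ ((5 / 2 : ℝ) * (k : ℝ)) * a k with hz
  have hx2 : ∑' k : ℤ, x k ^ 2 = Y := by rw [hx, tsum_half_sq]
  have hz2 : ∑' k : ℤ, z k ^ 2 = D := by
    have h := tsum_half_sq 5 a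
    norm_num at h
    rw [hz]
    exact h
  -- the constant after `paraT_weighted_le_gen`
  set K : ℝ≥0∞ := CB * G * Y ^ (1 / 2 : ℝ) * (2 : ℝ≥0∞) ^ (-(3 * c)) * (2 : ℝ≥0∞) ^ (-(κ / 2) * (m : ℝ)) with hK
  have hterm : ∀ j : ℤ, (2 : ℝ≥0∞) ^ (κ * (j : ℝ)) *
      (a j * (a (j + m) * paraT (fun l' => (2 : ℝ≥0∞) ^ l' * s l') (j + m))) ≤ K * (x j * z (j + m)) := by
    intro j
    have hT := paraT_weighted_le_gen a s CB hκ5 hB (j + m)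
    have epow : (2 : ℝ≥0∞) ^ (κ * (j : ℝ)) * (2 : ℝ≥0∞) ^ (c * (((j + m : ℤ) : ℝ) - 3)) =
        (2 : ℝ≥0∞) ^ (-(3 * c)) * (2 : ℝ≥0∞) ^ (-(κ / 2) * (m : ℝ)) *
          ((2 : ℝ≥0∞) ^ (κ / 2 * (j : ℝ)) * (2 : ℝ≥0∞) ^ ((5 / 2 : ℝ) * ((j + m : ℤ) : ℝ))) := by
      rw [← two_rpow_add, ← two_rpow_add, ← two_rpow_add, ← two_rpow_add]
      congr 1; push_cast; rw [hc]; ring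
    calc _ ≤ (2 : ℝ≥0∞) ^ (κ * (j : ℝ)) * (a j * (a (j + m) *
            (CB * (2 : ℝ≥0∞) ^ (c * (((j + m : ℤ) : ℝ) - 3)) * (G * Y ^ (1 / 2 : ℝ))))) := by gcongr
      _ = CB * G * Y ^ (1 / 2 : ℝ) * ((2 : ℝ≥0∞) ^ (κ * (j : ℝ)) * (2 : ℝ≥0∞) ^ (c * (((j + m : ℤ) : ℝ) - 3))) *
            (a j * a (j + m)) := by ring
      _ = K * (x j * z (j + m)) := by rw [epow, hK, hx, hz]; ring
  have hsum : ∑' j : ℤ, (2 : ℝ≥0∞) ^ (κ * (j : ℝ)) *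
      (a j * (a (j + m) * paraT (fun l' => (2 : ℝ≥0∞) ^ l' * s l') (j + m))) ≤ K * (Y ^ (1 / 2 : ℝ) * D ^ (1 / 2 : ℝ)) :=
    calc _ ≤ ∑' j : ℤ, K * (x j * z (j + m)) := ENNReal.tsum_le_tsum hterm
      _ = K * ∑' j : ℤ, x j * z (j + m) := ENNReal.tsum_mul_left
      _ ≤ K * (Y ^ (1 / 2 : ℝ) * D ^ (1 / 2 : ℝ)) := by
          rw [← hx2, ← hz2]
          exact mul_le_mul' le_rfl (tsum_mul_shift_le x z m)
  refine hsum.trans ?_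
  have hYY : Y ^ (1 / 2 : ℝ) * Y ^ (1 / 2 : ℝ) = Y := by
    rw [← sq, ← ENNReal.rpow_natCast, ← ENNReal.rpow_mul]; norm_num
  have hpow : (2 : ℝ≥0∞) ^ (-(3 * c)) * (2 : ℝ≥0∞) ^ (-(κ / 2) * (m : ℝ)) ≤ (2 : ℝ≥0∞) ^ κ := by
    rw [← two_rpow_add]
    have hm' : (-2 : ℝ) ≤ m := by exact_mod_cast hm
    refine ENNReal.rpow_le_rpow_of_exponent_le (by norm_num) ?_
    nlinarith
  calc K * (Y ^ (1 / 2 : ℝ) * D ^ (1 / 2 : ℝ))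
      = CB * ((2 : ℝ≥0∞) ^ (-(3 * c)) * (2 : ℝ≥0∞) ^ (-(κ / 2) * (m : ℝ))) * G *
          (Y ^ (1 / 2 : ℝ) * Y ^ (1 / 2 : ℝ)) * D ^ (1 / 2 : ℝ) := by rw [hK]; ring
    _ ≤ CB * (2 : ℝ≥0∞) ^ κ * G * (Y ^ (1 / 2 : ℝ) * Y ^ (1 / 2 : ℝ)) * D ^ (1 / 2 : ℝ) := by gcongr
    _ = CB * (2 : ℝ≥0∞) ^ κ * G * Y * D ^ (1 / 2 : ℝ) := by rw [hYY]

/-- **The high–high (fine-pairs) sum at weight `2^{κj}`** (`0 ≤ κ`): with `s_l ≤ C_B 2^{3l/2} a_l`,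
`∑_j 2^{κj} s_j Q_j ≤ 5 · C_B · 2^{3κ+8} · H_κ · (∑_j 2^{κj} a_j²) · (∑_j 32^j a_j²)^{1/2}`, `Q_j = paraQ2 a (2^· a) j`,
`H_κ = (∑_n 2^{−(κ+3)n/2})^{1/2}` (reindex to the fine level, Cauchy–Schwarz over the coarse offsets
`tsum_shift_le_sqrt` with `c = (κ+3)/2`, then `tsum_mul_shift_le`). [cite: CheskidovZaya2016, Thm. 2.2 (proof), Remark 2.3] -/
theorem highHigh_weighted_le_gen {κ : ℝ} (hκ0 : 0 ≤ κ)
    (hB : ∀ l : ℤ, s l ≤ CB * (2 : ℝ≥0∞) ^ ((3 / 2 : ℝ) * (l : ℝ)) * a l) :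
    ∑' j : ℤ, (2 : ℝ≥0∞) ^ (κ * (j : ℝ)) * (s j * paraQ2 a (fun l => (2 : ℝ≥0∞) ^ l * a l) j) ≤
      5 * CB * (2 : ℝ≥0∞) ^ (3 * κ + 8) * (∑' n : ℕ, ((2 : ℝ≥0∞) ^ (-((κ + 3) / 2))) ^ n) ^ (1 / 2 : ℝ) *
        (∑' j : ℤ, (2 : ℝ≥0∞) ^ (κ * (j : ℝ)) * a j ^ 2) *
          (∑' j : ℤ, (2 : ℝ≥0∞) ^ ((5 : ℝ) * (j : ℝ)) * a j ^ 2) ^ (1 / 2 : ℝ) := by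
  set Y : ℝ≥0∞ := ∑' j : ℤ, (2 : ℝ≥0∞) ^ (κ * (j : ℝ)) * a j ^ 2 with hY
  set D : ℝ≥0∞ := ∑' j : ℤ, (2 : ℝ≥0∞) ^ ((5 : ℝ) * (j : ℝ)) * a j ^ 2 with hD
  set ch : ℝ := (κ + 3) / 2 with hch
  have hch0 : 0 ≤ ch := by rw [hch]; linarith
  set Gh : ℝ≥0∞ := (∑' n : ℕ, ((2 : ℝ≥0∞) ^ (-ch)) ^ n) ^ (1 / 2 : ℝ) with hGh
  set x : ℤ → ℝ≥0∞ := fun k => (2 : ℝ≥0∞) ^ (κ / 2 * (k : ℝ)) * a k with hx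
  set z : ℤ → ℝ≥0∞ := fun k => (2 : ℝ≥0∞) ^ ((5 / 2 : ℝ) * (k : ℝ)) * a k with hz
  have hx2 : ∑' k : ℤ, x k ^ 2 = Y := by rw [hx, tsum_half_sq]
  have hz2 : ∑' k : ℤ, z k ^ 2 = D := by
    have h := tsum_half_sq 5 a
    norm_num at h
    rw [hz]
    exact h
  -- Bernstein in the `x`-form: `2^{κj} s_j ≤ CB 2^{ch j} x_j`
  have hBx : ∀ j : ℤ, (2 : ℝ≥0∞) ^ (κ * (j : ℝ)) * s j ≤ CB * ((2 : ℝ≥0∞) ^ (ch * (j : ℝ)) * x j) := by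
    intro j
    have epow : (2 : ℝ≥0∞) ^ (κ * (j : ℝ)) * (2 : ℝ≥0∞) ^ ((3 / 2 : ℝ) * (j : ℝ)) =
        (2 : ℝ≥0∞) ^ (ch * (j : ℝ)) * (2 : ℝ≥0∞) ^ (κ / 2 * (j : ℝ)) := by
      rw [← two_rpow_add, ← two_rpow_add]; congr 1; rw [hch]; ring
    calc (2 : ℝ≥0∞) ^ (κ * (j : ℝ)) * s j ≤ (2 : ℝ≥0∞) ^ (κ * (j : ℝ)) * (CB * (2 : ℝ≥0∞) ^ ((3 / 2 : ℝ) * (j : ℝ)) * a j) :=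
          mul_le_mul' le_rfl (hB j)
      _ = CB * (((2 : ℝ≥0∞) ^ (κ * (j : ℝ)) * (2 : ℝ≥0∞) ^ ((3 / 2 : ℝ) * (j : ℝ))) * a j) := by ring
      _ = CB * ((2 : ℝ≥0∞) ^ (ch * (j : ℝ)) * x j) := by rw [epow, hx]; ring
  set F : ℤ → ℤ → ℤ → ℝ≥0∞ := fun m j l =>
    (2 : ℝ≥0∞) ^ (ch * (j : ℝ)) * x j * (a l * ((2 : ℝ≥0∞) ^ (l + m) * a (l + m))) with hF
  have hstep1 : ∑' j : ℤ, (2 : ℝ≥0∞) ^ (κ * (j : ℝ)) * (s j * paraQ2 a (fun l => (2 : ℝ≥0∞) ^ l * a l) j) ≤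
      CB * ∑ m ∈ Finset.Icc (-2 : ℤ) 2, ∑' j : ℤ, ∑' n : ℕ, F m j (j - 4 + n) := by
    calc ∑' j : ℤ, (2 : ℝ≥0∞) ^ (κ * (j : ℝ)) * (s j * paraQ2 a (fun l => (2 : ℝ≥0∞) ^ l * a l) j)
        = ∑' j : ℤ, ((2 : ℝ≥0∞) ^ (κ * (j : ℝ)) * s j) * paraQ2 a (fun l => (2 : ℝ≥0∞) ^ l * a l) j :=
          tsum_congr fun j => by ring
      _ ≤ ∑' j : ℤ, (CB * ((2 : ℝ≥0∞) ^ (ch * (j : ℝ)) * x j)) * paraQ2 a (fun l => (2 : ℝ≥0∞) ^ l * a l) j :=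
          ENNReal.tsum_le_tsum fun j => mul_le_mul' (hBx j) le_rfl
      _ = CB * ∑' j : ℤ, ∑' n : ℕ, ∑ m ∈ Finset.Icc (-2 : ℤ) 2, F m j (j - 4 + n) := by
          rw [← ENNReal.tsum_mul_left]
          refine tsum_congr fun j => ?_
          rw [mul_assoc]
          congr 1
          simp only [paraQ2]
          rw [← ENNReal.tsum_mul_left]
          refine tsum_congr fun n => ?_
          simp only [hF, Finset.mul_sum]
      _ = CB * ∑ m ∈ Finset.Icc (-2 : ℤ) 2, ∑' j : ℤ, ∑' n : ℕ, F m j (j - 4 + n) := by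
          congr 1
          rw [← Summable.tsum_finsetSum (fun _ _ => ENNReal.summable)]
          refine tsum_congr fun j => ?_
          exact Summable.tsum_finsetSum (fun _ _ => ENNReal.summable)
  have hm_bound : ∀ m ∈ Finset.Icc (-2 : ℤ) 2, ∑' j : ℤ, ∑' n : ℕ, F m j (j - 4 + n) ≤
      (2 : ℝ≥0∞) ^ (3 * κ + 8) * Gh * Y * D ^ (1 / 2 : ℝ) := by
    intro m hm
    rw [Finset.mem_Icc] at hm
    rw [tsum_tsum_reindex (F m)]
    have hinner : ∀ l : ℤ, ∑' n : ℕ, (2 : ℝ≥0∞) ^ (ch * (((l + 4 - n : ℤ)) : ℝ)) * x (l + 4 - n) ≤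
        (2 : ℝ≥0∞) ^ (ch * ((l : ℝ) + 4)) * (Gh * Y ^ (1 / 2 : ℝ)) := by
      intro l
      have hre : ∀ n : ℕ, (2 : ℝ≥0∞) ^ (ch * (((l + 4 - n : ℤ)) : ℝ)) * x (l + 4 - n) =
          (2 : ℝ≥0∞) ^ (ch * ((l : ℝ) + 4)) * ((2 : ℝ≥0∞) ^ (-ch * (n : ℝ)) * x ((l + 4) - n)) := by
        intro n
        have hexp : ch * (((l + 4 - n : ℤ)) : ℝ) = ch * ((l : ℝ) + 4) + -ch * (n : ℝ) := by push_cast; ring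
        rw [hexp, two_rpow_add, mul_assoc]
      rw [tsum_congr hre, ENNReal.tsum_mul_left]
      refine mul_le_mul' le_rfl ((tsum_shift_le_sqrt x (l + 4) hch0).trans ?_)
      rw [hx2]
    have hsplit : ∀ l : ℤ, ∑' n : ℕ, F m (l + 4 - n) l =
        (∑' n : ℕ, (2 : ℝ≥0∞) ^ (ch * (((l + 4 - n : ℤ)) : ℝ)) * x (l + 4 - n)) *
          (a l * ((2 : ℝ≥0∞) ^ (l + m) * a (l + m))) := by
      intro l
      rw [← ENNReal.tsum_mul_right]
    have hcoef : ∀ l : ℤ, (2 : ℝ≥0∞) ^ (ch * ((l : ℝ) + 4)) * (a l * ((2 : ℝ≥0∞) ^ (l + m) * a (l + m))) =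
        (2 : ℝ≥0∞) ^ (4 * ch) * (2 : ℝ≥0∞) ^ ((1 - κ / 2) * (m : ℝ)) * (z l * x (l + m)) := by
      intro l
      simp only [hz, hx]
      rw [← ENNReal.rpow_intCast _ (l + m)]
      have epow : (2 : ℝ≥0∞) ^ (ch * ((l : ℝ) + 4)) * (2 : ℝ≥0∞) ^ (((l + m : ℤ) : ℝ)) =
          (2 : ℝ≥0∞) ^ (4 * ch) * (2 : ℝ≥0∞) ^ ((1 - κ / 2) * (m : ℝ)) *
            ((2 : ℝ≥0∞) ^ ((5 / 2 : ℝ) * (l : ℝ)) * (2 : ℝ≥0∞) ^ (κ / 2 * ((l + m : ℤ) : ℝ))) := by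
        rw [← two_rpow_add, ← two_rpow_add, ← two_rpow_add, ← two_rpow_add]
        congr 1; push_cast; rw [hch]; ring
      calc (2 : ℝ≥0∞) ^ (ch * ((l : ℝ) + 4)) * (a l * ((2 : ℝ≥0∞) ^ (((l + m : ℤ) : ℝ)) * a (l + m)))
          = ((2 : ℝ≥0∞) ^ (ch * ((l : ℝ) + 4)) * (2 : ℝ≥0∞) ^ (((l + m : ℤ) : ℝ))) * (a l * a (l + m)) := by ring
        _ = _ := by rw [epow]; ring
    have hpow : (2 : ℝ≥0∞) ^ (4 * ch) * (2 : ℝ≥0∞) ^ ((1 - κ / 2) * (m : ℝ)) ≤ (2 : ℝ≥0∞) ^ (3 * κ + 8) := by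
      rw [← two_rpow_add]
      have hm1 : (-2 : ℝ) ≤ m := by exact_mod_cast hm.1
      have hm2 : (m : ℝ) ≤ 2 := by exact_mod_cast hm.2
      refine ENNReal.rpow_le_rpow_of_exponent_le (by norm_num) ?_
      rw [hch]
      nlinarith
    have hYY : Y ^ (1 / 2 : ℝ) * Y ^ (1 / 2 : ℝ) = Y := by
      rw [← sq, ← ENNReal.rpow_natCast, ← ENNReal.rpow_mul]; norm_num
    calc ∑' l : ℤ, ∑' n : ℕ, F m (l + 4 - n) l
        = ∑' l : ℤ, (∑' n : ℕ, (2 : ℝ≥0∞) ^ (ch * (((l + 4 - n : ℤ)) : ℝ)) * x (l + 4 - n)) *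
            (a l * ((2 : ℝ≥0∞) ^ (l + m) * a (l + m))) := tsum_congr hsplit
      _ ≤ ∑' l : ℤ, ((2 : ℝ≥0∞) ^ (ch * ((l : ℝ) + 4)) * (Gh * Y ^ (1 / 2 : ℝ))) *
            (a l * ((2 : ℝ≥0∞) ^ (l + m) * a (l + m))) :=
          ENNReal.tsum_le_tsum fun l => mul_le_mul' (hinner l) le_rfl
      _ = ∑' l : ℤ, (Gh * Y ^ (1 / 2 : ℝ)) * ((2 : ℝ≥0∞) ^ (4 * ch) * (2 : ℝ≥0∞) ^ ((1 - κ / 2) * (m : ℝ)) *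
            (z l * x (l + m))) := by
          refine tsum_congr fun l => ?_
          rw [← hcoef l]; ring
      _ = (Gh * Y ^ (1 / 2 : ℝ)) * ((2 : ℝ≥0∞) ^ (4 * ch) * (2 : ℝ≥0∞) ^ ((1 - κ / 2) * (m : ℝ))) *
            ∑' l : ℤ, z l * x (l + m) := by
          rw [ENNReal.tsum_mul_left, ENNReal.tsum_mul_left]; ring
      _ ≤ (Gh * Y ^ (1 / 2 : ℝ)) * (2 : ℝ≥0∞) ^ (3 * κ + 8) * (D ^ (1 / 2 : ℝ) * Y ^ (1 / 2 : ℝ)) := by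
          refine mul_le_mul' (mul_le_mul' le_rfl hpow) ?_
          rw [← hz2, ← hx2]
          exact tsum_mul_shift_le z x m
      _ = (2 : ℝ≥0∞) ^ (3 * κ + 8) * Gh * (Y ^ (1 / 2 : ℝ) * Y ^ (1 / 2 : ℝ)) * D ^ (1 / 2 : ℝ) := by ring
      _ = (2 : ℝ≥0∞) ^ (3 * κ + 8) * Gh * Y * D ^ (1 / 2 : ℝ) := by rw [hYY]
  calc _ ≤ CB * ∑ m ∈ Finset.Icc (-2 : ℤ) 2, ∑' j : ℤ, ∑' n : ℕ, F m j (j - 4 + n) := hstep1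
    _ ≤ CB * ∑ m ∈ Finset.Icc (-2 : ℤ) 2, (2 : ℝ≥0∞) ^ (3 * κ + 8) * Gh * Y * D ^ (1 / 2 : ℝ) := by
        gcongr with m hm
        exact hm_bound m hm
    _ = CB * (5 * ((2 : ℝ≥0∞) ^ (3 * κ + 8) * Gh * Y * D ^ (1 / 2 : ℝ))) := by
        rw [Finset.sum_const]
        simp
    _ = 5 * CB * (2 : ℝ≥0∞) ^ (3 * κ + 8) * Gh * Y * D ^ (1 / 2 : ℝ) := by ring

/-- **THE RICCATI SUMMATION AT A GENERAL WEIGHT** (`0 ≤ κ < 5`; Cheskidov–Zaya 2016, Thm. 2.2 / Remark 2.3, in the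
tree's low-mode shapes). There is a finite `C = C_κ` such that for all `a, s ≥ 0` on `ℤ` with `s_l ≤ C_B 2^{3l/2} a_l`:
`∑_j 2^{κj} (a_j ∑_{|m|≤2} a_{j+m} T_{j+m} + s_j Q_j) ≤ C · C_B · (∑_j 2^{κj} a_j²) · (∑_j 32^j a_j²)^{1/2}`,
`T = paraT (2^· s)`, `Q = paraQ2 a (2^· a)` — the nonlinear side of the `2^{κj}`-weighted block balance is controlled by
`y_κ · D₅^{1/2}` with the SAME partner `D₅ = ∑_j 32^j a_j²` for every `κ`; at `κ = 3` this is `riccati_summation`. For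
`κ = 2s ∈ [3, 5)`, Hölder `D₅ ≤ y_κ^{s−3/2} D_κ^{5/2−s}` (`D_κ = ∑_j 2^{(κ+2)j} a_j²`) and Young turn it into
`ε D_κ + C' y_κ^{(2s+1)/(2s−1)}` — Cheskidov–Zaya's Riccati law for the optimal `Ḣ^s` rate.
[cite: CheskidovZaya2016, Thm. 2.2 (proof), Remark 2.3 (p. 6)] -/
theorem riccati_summation_gen {κ : ℝ} (hκ0 : 0 ≤ κ) (hκ5 : κ < 5) :
    ∃ C : ℝ≥0∞, C ≠ ∞ ∧ ∀ (a s : ℤ → ℝ≥0∞) (CB : ℝ≥0∞),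
      (∀ l : ℤ, s l ≤ CB * (2 : ℝ≥0∞) ^ ((3 / 2 : ℝ) * (l : ℝ)) * a l) →
      ∑' j : ℤ, (2 : ℝ≥0∞) ^ (κ * (j : ℝ)) *
          (a j * ∑ m ∈ Finset.Icc (-2 : ℤ) 2, a (j + m) * paraT (fun l' => (2 : ℝ≥0∞) ^ l' * s l') (j + m) +
            s j * paraQ2 a (fun l => (2 : ℝ≥0∞) ^ l * a l) j) ≤
        C * CB * (∑' j : ℤ, (2 : ℝ≥0∞) ^ (κ * (j : ℝ)) * a j ^ 2) *
          (∑' j : ℤ, (2 : ℝ≥0∞) ^ ((5 : ℝ) * (j : ℝ)) * a j ^ 2) ^ (1 / 2 : ℝ) := by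
  set G : ℝ≥0∞ := (∑' n : ℕ, ((2 : ℝ≥0∞) ^ (-((5 - κ) / 2))) ^ n) ^ (1 / 2 : ℝ) with hG
  set Gh : ℝ≥0∞ := (∑' n : ℕ, ((2 : ℝ≥0∞) ^ (-((κ + 3) / 2))) ^ n) ^ (1 / 2 : ℝ) with hGh
  have hGtop : G ≠ ∞ := ENNReal.rpow_ne_top_of_nonneg (by norm_num) (tsum_geom_ne_top (by linarith))
  have hGhtop : Gh ≠ ∞ := ENNReal.rpow_ne_top_of_nonneg (by norm_num) (tsum_geom_ne_top (by linarith))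
  have h2top : ∀ y : ℝ, (2 : ℝ≥0∞) ^ y ≠ ∞ := fun y => RiccatiSlice.two_rpow_ne_top y
  refine ⟨5 * (2 : ℝ≥0∞) ^ κ * G + 5 * (2 : ℝ≥0∞) ^ (3 * κ + 8) * Gh,
    ENNReal.add_ne_top.2 ⟨ENNReal.mul_ne_top (ENNReal.mul_ne_top (by norm_num) (h2top _)) hGtop,
      ENNReal.mul_ne_top (ENNReal.mul_ne_top (by norm_num) (h2top _)) hGhtop⟩,
    fun a s CB hB => ?_⟩
  set Y : ℝ≥0∞ := ∑' j : ℤ, (2 : ℝ≥0∞) ^ (κ * (j : ℝ)) * a j ^ 2 with hY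
  set D : ℝ≥0∞ := ∑' j : ℤ, (2 : ℝ≥0∞) ^ ((5 : ℝ) * (j : ℝ)) * a j ^ 2 with hD
  set T := fun l' : ℤ => (2 : ℝ≥0∞) ^ l' * s l' with hT
  have hsplit : ∑' j : ℤ, (2 : ℝ≥0∞) ^ (κ * (j : ℝ)) *
      (a j * ∑ m ∈ Finset.Icc (-2 : ℤ) 2, a (j + m) * paraT T (j + m) + s j * paraQ2 a (fun l => (2 : ℝ≥0∞) ^ l * a l) j) =
      (∑ m ∈ Finset.Icc (-2 : ℤ) 2, ∑' j : ℤ, (2 : ℝ≥0∞) ^ (κ * (j : ℝ)) * (a j * (a (j + m) * paraT T (j + m)))) +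
        ∑' j : ℤ, (2 : ℝ≥0∞) ^ (κ * (j : ℝ)) * (s j * paraQ2 a (fun l => (2 : ℝ≥0∞) ^ l * a l) j) := by
    rw [← Summable.tsum_finsetSum (fun _ _ => ENNReal.summable), ← ENNReal.tsum_add]
    refine tsum_congr fun j => ?_
    rw [mul_add, Finset.mul_sum, Finset.mul_sum]
  rw [hsplit]
  have hL : ∑ m ∈ Finset.Icc (-2 : ℤ) 2, ∑' j : ℤ, (2 : ℝ≥0∞) ^ (κ * (j : ℝ)) * (a j * (a (j + m) * paraT T (j + m))) ≤
      ∑ m ∈ Finset.Icc (-2 : ℤ) 2, CB * (2 : ℝ≥0∞) ^ κ * G * Y * D ^ (1 / 2 : ℝ) := by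
    refine Finset.sum_le_sum fun m hm => ?_
    rw [Finset.mem_Icc] at hm
    exact lowHigh_weighted_le_gen a s CB hκ0 hκ5 hB m hm.1
  have hH := highHigh_weighted_le_gen a s CB hκ0 hB
  calc _ ≤ (∑ m ∈ Finset.Icc (-2 : ℤ) 2, CB * (2 : ℝ≥0∞) ^ κ * G * Y * D ^ (1 / 2 : ℝ)) +
        5 * CB * (2 : ℝ≥0∞) ^ (3 * κ + 8) * Gh * Y * D ^ (1 / 2 : ℝ) := add_le_add hL hH
    _ = (5 * (2 : ℝ≥0∞) ^ κ * G + 5 * (2 : ℝ≥0∞) ^ (3 * κ + 8) * Gh) * CB * Y * D ^ (1 / 2 : ℝ) := by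
        rw [Finset.sum_const]
        simp
        ring

end Summit.NavierStokesRegularity.FluidComputer.RiccatiSummationGen

end
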